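import Literature.NumberTheory.Automorphic.JacquetLineExponents            -- ★ `jacquetMap_normalizedJacquet` (+ `JacquetModule`, `UnitaryGroupPrincipalSeriesExponents`)
import Literature.NumberTheory.Automorphic.JacquetModuleExactProofs          -- ★ `Representation.jacquetMap_injective`
import Literature.NumberTheory.Automorphic.ParabolicInductionQuotientProofs  -- ★ `Subrepresentation.mkQ`, `quotientRep`
import Literature.NumberTheory.Automorphic.UnitaryGroupBorelInduction        -- ★ `IrrClass.IsConstituentOf`, `IrrClass.mk_eq_mk_iff`
import HarnessLib

/-!
# A quotient character of the Jacquet module of a constituent of a line-filtered representation is one of the two characters;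
# hence such a constituent embeds into one of the two principal series (Casselman 1995, Lemma 7.1.1 (a), Cor. 6.3.9; Bernstein–Zelevinsky 1977)

Topic `NumberTheory/Automorphic`; namespace `Representation` (dot-notation extensions, as in the siblings `JacquetLineExponents`,
`JacquetNonzeroEmbedsNormalizedInd`).  THEOREMS ONLY: no definition, no named fact, no instance, no notation, no `sorry`.  Cell `hodgecm-mathlib`,
F0∕P3 «U3-mult», crux H413 (`stmt-HodgeConjecture-24833`), `--supports`: the GENERIC core of the N2 junction «★ N2 `U3PrincipalSeriesConstituentEmbeds`
⇐ ★ N1 `U3PrincipalSeriesJacquetFiltration` + (every constituent of `i_G(χ)` has non-zero Jacquet module) + ★ brick A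
`JacquetNonzeroEmbedsNormalizedInd`» (typ-T3b (g0) 16:39:19Z, input (ii) «`σ ∈ {χ, wχ}`»), done WITHOUT dimension counting and over an ABSTRACT parabolic
triple, so that the CM instantiation at `cmBorelTriple L 3 v` is one term-mode application (its hypotheses are, token for token, the body of ★ N1, the
★ `IrrClass.IsConstituentOf` datum, and the conclusion of ★ `exists_character_quotient_injective_intertwiningMap_normalizedInd`).  HONEST SCOPE: generic
lemmas only; nothing here is instantiated at `U(3)`, no letter closes, no `sorry` count changes; HC_CM is proved only modulo the printed citations until
rung 0 closes.

THE MATHEMATICS.  `t = (P, M, N)` a parabolic triple of a topological group `G` with `N` a limit of compact open subgroups (exactness of `r = r_t`,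
★ `Representation.jacquetMap_injective` [BernsteinZelevinsky1977 Prop. 1.9 (a)]); `I` a smooth representation whose normalised Jacquet module `r(I)`
has a `T`-stable submodule `ℓ` on which `T = M` acts by the character `wχ` and modulo which it acts by `χ` (the shape of [Casselman1995 Lemma 7.1.1 (a)]
for `i_G(χ)` of `U(3)`: ★ `U3PrincipalSeriesJacquetFiltration`).  Let `ρ ≅ V₁ ⁄ V₂` be a subquotient of `I` (`V₂ ≤ V₁` stable) and `ψ : r(ρ) → ℂ_θ` a
non-zero `T`-map (a QUOTIENT CHARACTER `θ` of `r(ρ)`).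
* §1 (linear algebra) `X →ι Y` injective and equivariant for families of operators, `ℓ ≤ Y` on which the operators are the scalars `wχ m` and modulo
  which they are `χ m`, `Ψ ≠ 0` a functional on `X` with `Ψ ∘ ρX(m) = θ m · Ψ`: then `θ = χ` or `θ = wχ` (read `θ` off a vector of `ι⁻¹ ℓ` where `Ψ ≠ 0`,
  or else off `ρX(m) x − χ m x ∈ ι⁻¹ ℓ`).
* §2 `Ψ := ψ ∘ r(e⁻¹) ∘ r(V₁ ↠ V₁ ⁄ V₂) : r(V₁) → ℂ` is non-zero and `θ`-equivariant (★ `jacquetMap_normalizedJacquet`; `r` is right exact), and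
  `r(V₁) ↪ r(I)` is injective and equivariant; §1 gives **`quotientCharacter_eq_or_eq : θ = χ ∨ θ = wχ`**.  Consequently
  (**`embeds_or_embeds_of_isConstituentOf_of_line`**): if `⟦r⟧` is a constituent of `I` (★ `IrrClass.IsConstituentOf`) and `r` embeds into
  `i_t(ℂ_θ)` for a quotient character `θ` of `r(r)` (the conclusion of ★ brick A), then `r ↪ i_t(ℂ_χ)` or `r ↪ i_t(ℂ_{wχ})`
  [Casselman1995 Cor. 6.3.9; BernsteinZelevinsky1977 Thm. 2.4 (b)].
The instances on the carrier of `I` are IMPLICIT binders (read off `I`), a deliberate choice for the CM consumer (instance re-synthesis on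
★ `cmPrincipalSeries` is what costs heartbeats there).

## References
* [Casselman1995] W. Casselman, *Introduction to the theory of admissible representations of `p`-adic reductive groups*, notes (draft 1 May 1995):
  Prop. 3.2.3, Lemma 7.1.1 (a), Cor. 6.3.9, Cor. 7.1.2.
* [BernsteinZelevinsky1977] I. N. Bernstein, A. V. Zelevinsky, *Induced representations of reductive `p`-adic groups I*, Ann. Sci. ÉNS (4) 10
  (1977) 441–472: Prop. 1.9 (a)(b), §2.3, Thm. 2.4 (b).
* [Rogawski1990] J. D. Rogawski, *Automorphic Representations of Unitary Groups in Three Variables*, Ann. of Math. Stud. 123 (1990): §12.1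
  pp. 171–172, §12.2 p. 173.
-/

set_option autoImplicit false

noncomputable section

open Literature.NumberTheory.Automorphic

namespace Representation

/-! ## §1 Linear algebra: a quotient character of a `T`-submodule of a module with a stable line and scalar quotient -/

/-- **A quotient character is one of the two characters of a line-filtered module.**  `Y` carries operators `ρY m` with a stable submodule `ℓ` on
which `ρY m` is the scalar `wχ m` and modulo which it is the scalar `χ m`; `X` carries operators `ρX m` and an INJECTIVE equivariant `ι : X → Y`; a
non-zero functional `Ψ` on `X` with `Ψ (ρX m x) = θ m · Ψ x`.  Then `θ = χ` or `θ = wχ`: on `ℓ₁ = ι⁻¹ ℓ` the operators are `wχ m` and modulo `ℓ₁`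
they are `χ m`; if `Ψ` does not vanish on `ℓ₁` read `θ` off a vector of `ℓ₁`, otherwise off `ρX m x − χ m x ∈ ℓ₁`. [cite: Casselman1995, Lemma 7.1.1 (a)] -/
theorem eq_or_eq_of_functional_of_line {T X Y : Type*} [AddCommGroup X] [Module ℂ X] [AddCommGroup Y] [Module ℂ Y]
    (ρX : T → X →ₗ[ℂ] X) (ρY : T → Y →ₗ[ℂ] Y) (ι : X →ₗ[ℂ] Y) (hι : Function.Injective ι)
    (hιT : ∀ (m : T) (x : X), ι (ρX m x) = ρY m (ι x)) (χ wχ θ : T → ℂ) (ℓ : Submodule ℂ Y)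
    (hℓw : ∀ (m : T), ∀ y ∈ ℓ, ρY m y = wχ m • y) (hℓχ : ∀ (m : T) (y : Y), ρY m y - χ m • y ∈ ℓ)
    (Ψ : X →ₗ[ℂ] ℂ) (hΨ : Ψ ≠ 0) (hΨT : ∀ (m : T) (x : X), Ψ (ρX m x) = θ m * Ψ x) : θ = χ ∨ θ = wχ := by
  by_cases h : ∃ x ∈ ℓ.comap ι, Ψ x ≠ 0
  · right
    obtain ⟨x, hx, hΨx⟩ := h
    funext m
    have h2 : ρX m x = wχ m • x := hι (by rw [hιT, hℓw m _ (Submodule.mem_comap.1 hx), map_smul])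
    have h1 := hΨT m x
    rw [h2, map_smul, smul_eq_mul] at h1
    exact (mul_right_cancel₀ hΨx h1).symm
  · left
    have h' : ∀ x ∈ ℓ.comap ι, Ψ x = 0 := fun x hx => not_ne_iff.mp fun hne => h ⟨x, hx, hne⟩
    obtain ⟨x₀, hx₀⟩ : ∃ x₀ : X, Ψ x₀ ≠ 0 := by
      by_contra h0
      exact hΨ (LinearMap.ext fun x => not_ne_iff.mp (not_exists.mp h0 x))
    funext m
    have hmem : ρX m x₀ - χ m • x₀ ∈ ℓ.comap ι := by
      rw [Submodule.mem_comap, map_sub, hιT, map_smul]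
      exact hℓχ m (ι x₀)
    have h1 := h' _ hmem
    rw [map_sub, hΨT, map_smul, smul_eq_mul, sub_eq_zero] at h1
    exact mul_right_cancel₀ hx₀ h1

/-! ## §2 Generic: a quotient character of `r_P(U)`, `U ≅ V₁ ⁄ V₂` a subquotient of `I`, is `χ` or `wχ` when `r_P(I)` is line-filtered

The instances on the carrier `VI` of `I` are IMPLICIT binders (`{_iA : AddCommGroup VI} {_iM : Module ℂ VI}`), not instance-implicit: at the CM
instantiation they are then READ OFF the type of `I = cmPrincipalSeries …` instead of being re-synthesised, so that the hypotheses produced by ★ N1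
unify syntactically (re-synthesis in a consumer file costs > 2·10⁶ heartbeats per clause). -/

section Generic

variable {G : Type*} [Group G] [TopologicalSpace G] [IsTopologicalGroup G] (t : ParabolicTriple G) [LocallyCompactSpace t.P]

omit [TopologicalSpace G] [IsTopologicalGroup G] [LocallyCompactSpace t.P] in
/-- The Jacquet map of a SURJECTIVE intertwining map is surjective (coinvariants are right exact). [cite: BernsteinZelevinsky1977, Prop. 1.9 (a)] -/
theorem jacquetMap_surjective_of_surjective {V W : Type*} [AddCommGroup V] [Module ℂ V] [AddCommGroup W] [Module ℂ W]
    {ρ : Representation ℂ G V} {σ : Representation ℂ G W} (f : ρ.IntertwiningMap σ) (hf : Function.Surjective f) :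
    Function.Surjective (Representation.jacquetMap t f) := by
  intro y
  obtain ⟨w, rfl⟩ := Representation.Coinvariants.mk_surjective _ y
  obtain ⟨v, rfl⟩ := hf w
  exact ⟨Representation.Coinvariants.mk _ v, Representation.jacquetMap_mk t f v⟩

/-- **A quotient character of the Jacquet module of a subquotient of a line-filtered `I` is one of the two characters** (generic over a
parabolic triple `t` with `t.N` a limit of compact open subgroups): `I` smooth, `r_t(I)` with a submodule `ℓ` on which `T` acts by `wχ` and modulo
which by `χ`; `V₂ ≤ V₁ ≤ I` stable, `ρ ≅ V₁ ⁄ V₂`, `ψ : r_t(ρ) → ℂ_θ` a non-zero `T`-map.  Then `θ = χ ∨ θ = wχ` — §1 with `Ψ = ψ ∘ r(e⁻¹) ∘ r(V₁ ↠ V₁⁄V₂)`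
and the injection `r(V₁) ↪ r(I)` (★ `Representation.jacquetMap_injective`). [cite: Casselman1995, Lemma 7.1.1 (a), Prop. 3.2.3]
[cite: BernsteinZelevinsky1977, Prop. 1.9 (a)] -/
theorem quotientCharacter_eq_or_eq (hN : IsLimitOfCompactOpen ↥t.N)
    {VI : Type*} {_iA : AddCommGroup VI} {_iM : Module ℂ VI} (I : Representation ℂ G VI) (hI : I.IsSmooth)
    (χ wχ : ↥t.M →* ℂˣ) (ℓ : Submodule ℂ (t.restrict I).Coinvariants)
    (hℓw : ∀ (m : ↥t.M), ∀ x ∈ ℓ, I.normalizedJacquet t m x = ((wχ m : ℂˣ) : ℂ) • x)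
    (hℓχ : ∀ (m : ↥t.M) (x : (t.restrict I).Coinvariants), I.normalizedJacquet t m x - ((χ m : ℂˣ) : ℂ) • x ∈ ℓ)
    (N₁ N₂ : Subrepresentation I) {W : Type*} [AddCommGroup W] [Module ℂ W] (ρ : Representation ℂ G W)
    (e : ρ.Equiv (N₁.toRepresentation.quotient (N₂.toSubmodule.comap N₁.toSubmodule.subtype)
      fun g _ hx ↦ N₂.apply_mem_toSubmodule g hx))
    (θ : ↥t.M →* ℂˣ) (ψ : (ρ.normalizedJacquet t).IntertwiningMap ((Representation.trivial ℂ ↥t.M ℂ).twist θ)) (hψ : ψ ≠ 0) :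
    θ = χ ∨ θ = wχ := by
  -- the subquotient as the quotient of `N₁` by a subrepresentation `P'`
  let P' : Subrepresentation N₁.toRepresentation :=
    { toSubmodule := N₂.toSubmodule.comap N₁.toSubmodule.subtype
      apply_mem_toSubmodule := fun g x hx =>
        Submodule.mem_comap.2 (N₂.apply_mem_toSubmodule g (Submodule.mem_comap.1 hx)) }
  -- the given equivalence, read with target `P'.quotientRep` (the same representation, by proof irrelevance)
  let e' : ρ.Equiv P'.quotientRep := e
  -- the inclusion `N₁ ↪ I` and its injective Jacquet map
  let ι₁ : N₁.toRepresentation.IntertwiningMap I :=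
    { toLinearMap := N₁.toSubmodule.subtype
      isIntertwining' := fun g => LinearMap.ext fun x => rfl }
  have hιinj : Function.Injective (Representation.jacquetMap t ι₁) :=
    Representation.jacquetMap_injective t hN hI ι₁ (Submodule.injective_subtype _)
  -- Jacquet maps of the quotient map and of `e⁻¹`
  let jq := Representation.jacquetMap t P'.mkQ
  let je := Representation.jacquetMap t e'.symm.toIntertwiningMap
  have hjq : Function.Surjective jq := jacquetMap_surjective_of_surjective t P'.mkQ P'.mkQ_surjective
  -- the functional `Ψ : r(N₁) → ℂ` and its equivariance
  let Ψ : (t.restrict N₁.toRepresentation).Coinvariants →ₗ[ℂ] ℂ := ψ.toLinearMap ∘ₗ je.toLinearMap ∘ₗ jq.toLinearMap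
  have hΨapply : ∀ x, Ψ x = ψ (je (jq x)) := fun x => rfl
  have hΨT : ∀ (m : ↥t.M) (x : (t.restrict N₁.toRepresentation).Coinvariants),
      Ψ (N₁.toRepresentation.normalizedJacquet t m x) = ((θ m : ℂˣ) : ℂ) * Ψ x := by
    intro m x
    rw [hΨapply, hΨapply, Representation.jacquetMap_normalizedJacquet, Representation.jacquetMap_normalizedJacquet,
      ψ.isIntertwining, Representation.twist_apply, Representation.trivial_apply, smul_eq_mul]
  -- `Ψ ≠ 0`
  have hΨ : Ψ ≠ 0 := by
    obtain ⟨z, hz⟩ : ∃ z, ψ z ≠ 0 := by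
      by_contra h0
      exact hψ (Representation.IntertwiningMap.ext (LinearMap.ext fun z => not_ne_iff.mp (not_exists.mp h0 z)))
    obtain ⟨z₀, rfl⟩ := Representation.Coinvariants.mk_surjective _ z
    obtain ⟨x₀, hx₀⟩ := P'.mkQ_surjective (e' z₀)
    intro hΨ0
    apply hz
    have h1 : Ψ (Representation.Coinvariants.mk _ x₀) = 0 := by rw [hΨ0]; rfl
    rw [hΨapply] at h1
    have h2 : je (jq (Representation.Coinvariants.mk _ x₀)) = Representation.Coinvariants.mk _ z₀ := by
      show Representation.jacquetMap t e'.symm.toIntertwiningMap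
          (Representation.jacquetMap t P'.mkQ (Representation.Coinvariants.mk _ x₀)) = _
      rw [Representation.jacquetMap_mk, Representation.jacquetMap_mk, hx₀]
      exact congrArg _ (e'.symm_apply_apply z₀)
    rwa [h2] at h1
  -- §1
  have key := eq_or_eq_of_functional_of_line (T := ↥t.M)
    (fun m => (N₁.toRepresentation.normalizedJacquet t m : _ →ₗ[ℂ] _)) (fun m => (I.normalizedJacquet t m : _ →ₗ[ℂ] _))
    (Representation.jacquetMap t ι₁).toLinearMap hιinj (fun m x => Representation.jacquetMap_normalizedJacquet t ι₁ m x)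
    (fun m => ((χ m : ℂˣ) : ℂ)) (fun m => ((wχ m : ℂˣ) : ℂ)) (fun m => ((θ m : ℂˣ) : ℂ)) ℓ hℓw hℓχ Ψ hΨ hΨT
  rcases key with h | h
  · exact Or.inl (MonoidHom.ext fun m => Units.ext (congrFun h m))
  · exact Or.inr (MonoidHom.ext fun m => Units.ext (congrFun h m))


/-- **Constituents of a line-filtered induced representation embed into one of the two principal series** (generic; the shape consumed
at the CM Borel triple): if `r_t(I)` is two-dimensional with a line `ℓ` on which `T` acts by `wχ` and modulo which by `χ` (the text of ★
`U3PrincipalSeriesJacquetFiltration`, generic `t`, `I`), `c = ⟦r⟧` is a constituent of `I` (★ `IrrClass.IsConstituentOf`), and `r` embeds into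
`i_t(ℂ_θ)` for a QUOTIENT CHARACTER `θ` of `r_t(r)` (the text of ★ brick A `exists_character_quotient_injective_intertwiningMap_normalizedInd`),
then `r ↪ i_t(ℂ_χ)` or `r ↪ i_t(ℂ_{wχ})`. [cite: Casselman1995, Lemma 7.1.1 (a), Cor. 6.3.9] [cite: BernsteinZelevinsky1977, Prop. 1.9 (a)(b), Thm. 2.4 (b)] -/
theorem embeds_or_embeds_of_isConstituentOf_of_line (hN : IsLimitOfCompactOpen ↥t.N)
    {VI : Type*} {_iA : AddCommGroup VI} {_iM : Module ℂ VI} (I : Representation ℂ G VI) (hI : I.IsSmooth) (χ wχ : ↥t.M →* ℂˣ)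
    (hline : FiniteDimensional ℂ (t.restrict I).Coinvariants ∧ Module.finrank ℂ (t.restrict I).Coinvariants = 2 ∧
      ∃ ℓ : Submodule ℂ (t.restrict I).Coinvariants, Module.finrank ℂ ↥ℓ = 1 ∧
        (∀ (m : ↥t.M), ∀ x ∈ ℓ, I.normalizedJacquet t m x = ((wχ m : ℂˣ) : ℂ) • x) ∧
        (∀ (m : ↥t.M) (x : (t.restrict I).Coinvariants), I.normalizedJacquet t m x - ((χ m : ℂˣ) : ℂ) • x ∈ ℓ))
    (r : SmoothIrrep G) (hc : (IrrClass.mk r).IsConstituentOf I)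
    (hA : ∃ θ : ↥t.M →* ℂˣ,
      (∃ ψ : (r.ρ.normalizedJacquet t).IntertwiningMap ((Representation.trivial ℂ ↥t.M ℂ).twist θ), ψ ≠ 0) ∧
      ∃ f : r.ρ.IntertwiningMap (Representation.normalizedInd t ((Representation.trivial ℂ ↥t.M ℂ).twist θ)), Function.Injective f) :
    (∃ f : r.ρ.IntertwiningMap (Representation.normalizedInd t ((Representation.trivial ℂ ↥t.M ℂ).twist χ)), Function.Injective f) ∨
    (∃ f : r.ρ.IntertwiningMap (Representation.normalizedInd t ((Representation.trivial ℂ ↥t.M ℂ).twist wχ)), Function.Injective f) := by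
  obtain ⟨-, -, ℓ, -, hℓw, hℓχ⟩ := hline
  obtain ⟨r', hr', N₁, N₂, -, ⟨e'⟩⟩ := hc
  obtain ⟨e₀⟩ := (IrrClass.mk_eq_mk_iff r r').1 hr'.symm
  obtain ⟨θ, ⟨ψ, hψ⟩, f, hf⟩ := hA
  have hθ := quotientCharacter_eq_or_eq t hN I hI χ wχ ℓ hℓw hℓχ N₁ N₂ r.ρ (e₀.trans e') θ ψ hψ
  rcases hθ with hθ | hθ
  · subst hθ; exact Or.inl ⟨f, hf⟩
  · subst hθ; exact Or.inr ⟨f, hf⟩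

end Generic

end Representation

end
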